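import Mathlib.Tactic
import HarnessLib

set_option linter.dupNamespace false -- namespace `…BirchSwinnertonDyer.BirchSwinnertonDyer…` is the cell's (D-0017 nested layout)
set_option autoImplicit false

/-!
# LINE C3⁺ (PHASE 2 of the mixed 2-rank-two family), file P2a: the QUARTER-TRACE CORE — the mod-`4` bookkeeping
# of Gross's half-trace device for an imaginary quadratic field whose class group has `2`-rank two (FACT-FREE)

Cell `bsd-goldfeld`, seat `bsd-goldfeld-s1p-c3x` (gen 7); planner ORDER (ccxxix)/(ccxxxi) «LINE C3⁺, tranche 1», file P2a.
`--supports stmt-BirchSwinnertonDyer-20044` as a HELPER (rank axis; the target THEOREM A⁗ is an instance family of K12₂″'s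
registered stub 2 `X049HeegnerNonTorsionEvenDiscr`). Theses-free, Literature-free (imports `Mathlib.Tactic`); theorems only,
about an ABSTRACT abelian group — no curve, no field, no fact binder, no `sorry`. Models: seat c201's
`GoldfeldK12AdditiveTwoHalfTraceCore`, this seat's `…TwinHalfTraceSevenModEightCore`, c301's `secondHalving_cm7`.

THE ALGEBRA (memo `HOME/RK2-MIXED-FAMILY.md` §2). `M` is an abelian group (in the application: `X₀(49)(L)`, `L = K[1]` the
Hilbert class field of `K = ℚ(√−2qp)`), `c : M →+ M` (complex conjugation), `T ∈ M` with `2T = 0`, `T ≠ 0`, `cT = T`, and the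
torsion hypothesis `4x = 0 ⇒ x ∈ {0, T}` (`X₀(49)(L)[4] = {O, T}`, file P2f). Data: the quarter trace `Ψ` (sum of the conductor-one
Heegner points over `Cl(K)²`) with `4Ψ = y + P_e + P_q + P_p` (the three genus components) and `cΨ + Ψ = κT` (`κ = h_K/4`, Gross's
conjugation law summed, ty FILE D); the level-one half trace `Ψ_q` with `2Ψ_q = y + P_q`, `cΨ_q + Ψ_q = 0` (`h_K/2` even); the
partner data `P_e = 4R_e + t_e`, `cR_e + R_e = ε_e T`; `P_p = 4R_p + t_p`, `cR_p + R_p = ε_p T`; `P_q = n·Y + t_q` with the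
partner Heegner point `Y = y_{ℚ(√−q)}`, `cY + Y = T` (Birch: `h(−q)` odd); all `t_• ∈ {0, T}`. CONCLUSION
(`quarterTrace_parity`): if `y ∈ {0, T}` (the Heegner point of `K` is torsion) then **`4 ∣ n` and `κ ≡ ε_e + ε_p + n/4 (mod 2)`**;
contrapositive `quarterTrace_not_torsion`. The odd-multiplier form the partner files deliver (`M_e•P_e = …`, `M_q•P_q = …`,
`M_p•P_p = …`, `M_•` odd) is reduced to it by `quarterTrace_parity_of_odd_smul` (scale everything by `M_e M_q M_p`).
In THEOREM A⁗ (cells with `p ≡ 5 (mod 8)`): `ε_e = [type β]`, `ε_p = [type α ∧ q ≡ 7 (8)]`, `n/4` odd (LINE C3's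
`ord₂ L^{alg}(49a1^{(2p)},1) = 3`), and `κ = h(−8qp)/4` is odd (Rédei) — contradiction in cells C4, C6, C8.

HONEST FRAMING: pure group algebra; no Heegner point is constructed here and no case of K12₂″ / twin″ is decided; BSD is not
proved by any of this.
References: Gross 1984 §§4–5 [Gross1984]; Gross, LMS LN 153 (1991) Prop. 5.3 [GrossLMS1991]; Coates–Li–Tian–Zhai, PLMS 110 (2015) Thm. 2.5 [CoatesLiTianZhai2015].
-/

namespace Summit.BirchSwinnertonDyer.BirchSwinnertonDyer.Theorems.GoldfeldGoodTwists

section QuarterTraceCore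

variable {M : Type*} [AddCommGroup M]

/-! ## §1 The two-element set `{0, T}` with `2T = 0` -/

/-- `n • T = 0 ↔ n` even, for `T ≠ 0` with `2T = 0`. [folklore] -/
theorem zsmul_twoTorsion_eq_zero_iff {T : M} (hT2 : 2 • T = 0) (hT0 : T ≠ 0) (n : ℤ) :
    n • T = 0 ↔ Even n := by
  have hT2z : (2 : ℤ) • T = 0 := by exact_mod_cast hT2
  constructor
  · intro h
    by_contra hodd
    rw [Int.not_even_iff_odd] at hodd
    obtain ⟨k, rfl⟩ := hodd
    apply hT0
    have e : (2 * k + 1) • T = k • ((2 : ℤ) • T) + T := by rw [add_zsmul, one_zsmul, mul_comm, mul_zsmul]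
    rw [e, hT2z, zsmul_zero, zero_add] at h
    exact h
  · rintro ⟨k, rfl⟩
    rw [← two_mul, mul_comm, mul_zsmul, hT2z, zsmul_zero]

/-- An odd multiple of `T` is `T` (`2T = 0`). [folklore] -/
theorem zsmul_twoTorsion_of_odd {T : M} (hT2 : 2 • T = 0) {n : ℤ} (hn : Odd n) : n • T = T := by
  have hT2z : (2 : ℤ) • T = 0 := by exact_mod_cast hT2
  obtain ⟨k, rfl⟩ := hn
  rw [add_zsmul, one_zsmul, mul_comm, mul_zsmul, hT2z, zsmul_zero, zero_add]

/-- `{0, T}` is closed under addition (`2T = 0`). [folklore] -/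
theorem add_mem_zero_or_twoTorsion {T x y : M} (hT2 : 2 • T = 0) (hx : x = 0 ∨ x = T) (hy : y = 0 ∨ y = T) :
    x + y = 0 ∨ x + y = T := by
  rcases hx with hx | hx <;> rcases hy with hy | hy <;> rw [hx, hy]
  · left; rw [add_zero]
  · right; rw [zero_add]
  · right; rw [add_zero]
  · left; rw [← two_nsmul, hT2]

/-- An integer multiple of an element of `{0, T}` is in `{0, T}` (`2T = 0`). [folklore] -/
theorem zsmul_mem_zero_or_twoTorsion {T x : M} (hT2 : 2 • T = 0) (hx : x = 0 ∨ x = T) (m : ℤ) :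
    m • x = 0 ∨ m • x = T := by
  rcases hx with hx | hx <;> rw [hx]
  · left; exact zsmul_zero m
  · rcases Int.even_or_odd m with hm | hm
    · left
      obtain ⟨k, rfl⟩ := hm
      have hT2z : (2 : ℤ) • T = 0 := by exact_mod_cast hT2
      rw [← two_mul, mul_comm, mul_zsmul, hT2z, zsmul_zero]
    · right; exact zsmul_twoTorsion_of_odd hT2 hm

/-- `c x + x = 0` for `x ∈ {0, T}` when `c T = T`, `2T = 0`. [folklore] -/
theorem map_add_self_eq_zero_of_mem {T x : M} (c : M →+ M) (hT2 : 2 • T = 0) (hcT : c T = T)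
    (hx : x = 0 ∨ x = T) : c x + x = 0 := by
  rcases hx with hx | hx <;> rw [hx]
  · rw [map_zero, add_zero]
  · rw [hcT, ← two_nsmul, hT2]

/-- From `4 • Z ∈ {0, T}` and `M[4] = {0, T}`: `Z ∈ {0, T}`. [folklore] -/
theorem mem_of_four_zsmul_mem {T Z : M} (hT2 : 2 • T = 0) (hT0 : T ≠ 0)
    (h4 : ∀ x : M, (4 : ℤ) • x = 0 → x = 0 ∨ x = T) (hZ : (4 : ℤ) • Z = 0 ∨ (4 : ℤ) • Z = T) :
    Z = 0 ∨ Z = T := by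
  have hT2z : (2 : ℤ) • T = 0 := by exact_mod_cast hT2
  rcases hZ with h0 | hT
  · exact h4 Z h0
  · exfalso
    have h8 : (4 : ℤ) • ((2 : ℤ) • Z) = 0 := by
      rw [← mul_zsmul, show (4 * 2 : ℤ) = 2 * 4 by norm_num, mul_zsmul, hT, hT2z]
    have h4Z : (4 : ℤ) • Z = (2 : ℤ) • ((2 : ℤ) • Z) := by rw [← mul_zsmul]; norm_num
    rcases h4 _ h8 with h0 | h1
    · apply hT0; rw [← hT, h4Z, h0, zsmul_zero]
    · apply hT0; rw [← hT, h4Z, h1, hT2z]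

/-! ## §2 The quarter-trace parity law -/

/-- **THE QUARTER-TRACE PARITY LAW (the core of the mod-`4` half-trace device at `2`-rank two).** In an abelian group `M` with an
additive map `c`, an element `T` of order `2` fixed by `c` and `M[4] = {0, T}`: if `4Ψ = y + P_e + P_q + P_p`, `cΨ + Ψ = κT`,
`2Ψ_q = y + P_q`, `cΨ_q + Ψ_q = 0`, `P_e = 4R_e + t_e` with `cR_e + R_e = ε_e T`, `P_p = 4R_p + t_p` with `cR_p + R_p = ε_p T`,
`P_q = n•Y + t_q` with `cY + Y = T`, `t_e, t_q, t_p ∈ {0, T}`, and the point `y` is TORSION (`y ∈ {0, T}`), then `n = 4n₂` and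
`κ ≡ ε_e + ε_p + n₂ (mod 2)`. [cite: CoatesLiTianZhai2015, Thm. 2.5 (the half-trace device)] [cite: GrossLMS1991, Prop. 5.3] -/
theorem quarterTrace_parity (c : M →+ M) {T : M} (hT2 : 2 • T = 0) (hT0 : T ≠ 0)
    (h4 : ∀ x : M, (4 : ℤ) • x = 0 → x = 0 ∨ x = T) (hcT : c T = T)
    {Ψ Ψq y Pe Pq Pp Y Re Rp te tq tp : M} {κ εe εp n : ℤ}
    (hΨ : (4 : ℤ) • Ψ = y + Pe + Pq + Pp) (hcΨ : c Ψ + Ψ = κ • T)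
    (hΨq : (2 : ℤ) • Ψq = y + Pq) (hcΨq : c Ψq + Ψq = 0) (hy : y = 0 ∨ y = T)
    (hPe : Pe = (4 : ℤ) • Re + te) (hRe : c Re + Re = εe • T) (hte : te = 0 ∨ te = T)
    (hPp : Pp = (4 : ℤ) • Rp + tp) (hRp : c Rp + Rp = εp • T) (htp : tp = 0 ∨ tp = T)
    (hPq : Pq = n • Y + tq) (hY : c Y + Y = T) (htq : tq = 0 ∨ tq = T) :
    ∃ n₂ : ℤ, n = 4 * n₂ ∧ Even (κ - εe - εp - n₂) := by
  have hT2z : (2 : ℤ) • T = 0 := by exact_mod_cast hT2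
  have hcy : c y + y = 0 := map_add_self_eq_zero_of_mem c hT2 hcT hy
  have hctq : c tq + tq = 0 := map_add_self_eq_zero_of_mem c hT2 hcT htq
  ------------------------------------------------------------------ step 1: `2 ∣ n` from `(c+1)(2Ψ_q) = 0 = nT`
  have hnT : n • T = 0 := by
    have h1 : c ((2 : ℤ) • Ψq) + (2 : ℤ) • Ψq = 0 := by
      rw [map_zsmul, ← zsmul_add, hcΨq, zsmul_zero]
    rw [hΨq, hPq, map_add, map_add, map_zsmul] at h1
    have h2 : n • (c Y + Y) + (c y + y) + (c tq + tq) = 0 := by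
      rw [zsmul_add, ← h1]; abel
    rwa [hY, hcy, hctq, add_zero, add_zero] at h2
  obtain ⟨n₁, hn₁⟩ := (zsmul_twoTorsion_eq_zero_iff hT2 hT0 n).mp hnT
  have hn : n = 2 * n₁ := by rw [hn₁]; ring
  ------------------------------------------------------------------ step 2: `4 ∣ n` from `W := Ψ_q − n₁•Y ∈ {0,T}`
  have hW2 : (2 : ℤ) • (Ψq - n₁ • Y) = y + tq := by
    rw [zsmul_sub, hΨq, hPq, hn, mul_zsmul]; abel
  have hWmem : Ψq - n₁ • Y = 0 ∨ Ψq - n₁ • Y = T := by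
    refine mem_of_four_zsmul_mem hT2 hT0 h4 ?_
    have e : (4 : ℤ) • (Ψq - n₁ • Y) = (2 : ℤ) • (y + tq) := by
      rw [← hW2, ← mul_zsmul]; norm_num
    rw [e]
    left
    rcases add_mem_zero_or_twoTorsion hT2 hy htq with h0 | h1
    · rw [h0, zsmul_zero]
    · rw [h1, hT2z]
  have hn₁T : n₁ • T = 0 := by
    have h1 := map_add_self_eq_zero_of_mem c hT2 hcT hWmem
    rw [map_sub, map_zsmul] at h1
    have h2 : (c Ψq + Ψq) - n₁ • (c Y + Y) = 0 := by rw [zsmul_add, ← h1]; abel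
    rw [hcΨq, hY, zero_sub, neg_eq_zero] at h2
    exact h2
  obtain ⟨n₂, hn₂⟩ := (zsmul_twoTorsion_eq_zero_iff hT2 hT0 n₁).mp hn₁T
  have hn4 : n = 4 * n₂ := by rw [hn, hn₂]; ring
  ------------------------------------------------------------------ step 3: parity from `Z := Ψ − R_e − n₂•Y − R_p ∈ {0,T}`
  have htsum : y + te + tq + tp = 0 ∨ y + te + tq + tp = T :=
    add_mem_zero_or_twoTorsion hT2 (add_mem_zero_or_twoTorsion hT2 (add_mem_zero_or_twoTorsion hT2 hy hte) htq) htp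
  have hZ4 : (4 : ℤ) • (Ψ - Re - n₂ • Y - Rp) = y + te + tq + tp := by
    rw [zsmul_sub, zsmul_sub, zsmul_sub, hΨ, hPe, hPp, hPq, hn4, mul_zsmul]; abel
  have hZmem : Ψ - Re - n₂ • Y - Rp = 0 ∨ Ψ - Re - n₂ • Y - Rp = T :=
    mem_of_four_zsmul_mem hT2 hT0 h4 (by rw [hZ4]; exact htsum)
  have hpar : (κ - εe - n₂ - εp) • T = 0 := by
    have h1 := map_add_self_eq_zero_of_mem c hT2 hcT hZmem
    rw [map_sub, map_sub, map_sub, map_zsmul] at h1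
    have h2 : (c Ψ + Ψ) - (c Re + Re) - n₂ • (c Y + Y) - (c Rp + Rp) = 0 := by rw [zsmul_add, ← h1]; abel
    rw [hcΨ, hRe, hY, hRp] at h2
    simp only [sub_smul]
    exact h2
  refine ⟨n₂, hn4, ?_⟩
  have := (zsmul_twoTorsion_eq_zero_iff hT2 hT0 _).mp hpar
  rw [show κ - εe - εp - n₂ = κ - εe - n₂ - εp by ring]
  exact this

/-- **Contrapositive (the form THEOREM A⁗ uses):** with the same data, if for every `n₂` with `n = 4n₂` the integer
`κ − ε_e − ε_p − n₂` is ODD, then `y ∉ {0, T}` — the Heegner point of `K` is not killed by `X₀(49)(K)_tors = {O, T}`.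
[cite: CoatesLiTianZhai2015, Thm. 2.5] -/
theorem quarterTrace_not_torsion (c : M →+ M) {T : M} (hT2 : 2 • T = 0) (hT0 : T ≠ 0)
    (h4 : ∀ x : M, (4 : ℤ) • x = 0 → x = 0 ∨ x = T) (hcT : c T = T)
    {Ψ Ψq y Pe Pq Pp Y Re Rp te tq tp : M} {κ εe εp n : ℤ}
    (hΨ : (4 : ℤ) • Ψ = y + Pe + Pq + Pp) (hcΨ : c Ψ + Ψ = κ • T)
    (hΨq : (2 : ℤ) • Ψq = y + Pq) (hcΨq : c Ψq + Ψq = 0)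
    (hPe : Pe = (4 : ℤ) • Re + te) (hRe : c Re + Re = εe • T) (hte : te = 0 ∨ te = T)
    (hPp : Pp = (4 : ℤ) • Rp + tp) (hRp : c Rp + Rp = εp • T) (htp : tp = 0 ∨ tp = T)
    (hPq : Pq = n • Y + tq) (hY : c Y + Y = T) (htq : tq = 0 ∨ tq = T)
    (hodd : ∀ n₂ : ℤ, n = 4 * n₂ → Odd (κ - εe - εp - n₂)) :
    y ≠ 0 ∧ y ≠ T := by
  have key : ¬ (y = 0 ∨ y = T) := fun hy => by
    obtain ⟨n₂, hn, heven⟩ := quarterTrace_parity c hT2 hT0 h4 hcT hΨ hcΨ hΨq hcΨq hy hPe hRe hte hPp hRp htp hPq hY htq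
    exact (Int.not_odd_iff_even.mpr heven) (hodd n₂ hn)
  exact ⟨fun h => key (Or.inl h), fun h => key (Or.inr h)⟩

/-! ## §3 The odd-multiplier form delivered by the partner files -/

/-- **Odd-multiplier reduction.** The partner files prove the three relations only up to ODD integer multipliers
(`M_e • P_e = 4•R_e + t_e`, `M_q • P_q = n•Y + t_q`, `M_p • P_p = 4•R_p + t_p`, from height ratios with odd numerators and
denominators); scaling all data by `M_e M_q M_p` (odd, so `{0,T}` and the parities of `κ, ε_e, ε_p` are unchanged) gives the
hypotheses of `quarterTrace_parity`. Conclusion: `M_e M_p n = 4 n₂` for some `n₂` with `κ ≡ ε_e + ε_p + n₂ (mod 2)`.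
[cite: CoatesLiTianZhai2015, Thm. 2.5] -/
theorem quarterTrace_parity_of_odd_smul (c : M →+ M) {T : M} (hT2 : 2 • T = 0) (hT0 : T ≠ 0)
    (h4 : ∀ x : M, (4 : ℤ) • x = 0 → x = 0 ∨ x = T) (hcT : c T = T)
    {Ψ Ψq y Pe Pq Pp Y Re Rp te tq tp : M} {κ εe εp n Me Mq Mp : ℤ}
    (hMe : Odd Me) (hMq : Odd Mq) (hMp : Odd Mp)
    (hΨ : (4 : ℤ) • Ψ = y + Pe + Pq + Pp) (hcΨ : c Ψ + Ψ = κ • T)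
    (hΨq : (2 : ℤ) • Ψq = y + Pq) (hcΨq : c Ψq + Ψq = 0) (hy : y = 0 ∨ y = T)
    (hPe : Me • Pe = (4 : ℤ) • Re + te) (hRe : c Re + Re = εe • T) (hte : te = 0 ∨ te = T)
    (hPp : Mp • Pp = (4 : ℤ) • Rp + tp) (hRp : c Rp + Rp = εp • T) (htp : tp = 0 ∨ tp = T)
    (hPq : Mq • Pq = n • Y + tq) (hY : c Y + Y = T) (htq : tq = 0 ∨ tq = T) :
    ∃ n₂ : ℤ, Me * Mp * n = 4 * n₂ ∧ Even (κ - εe - εp - n₂) := by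
  set N : ℤ := Me * Mq * Mp with hNdef
  have hN : Odd N := (hMe.mul hMq).mul hMp
  -- the scaled data
  have hΨ' : (4 : ℤ) • (N • Ψ) = N • y + N • Pe + N • Pq + N • Pp := by
    rw [smul_comm, hΨ, zsmul_add, zsmul_add, zsmul_add]
  have hcΨ' : c (N • Ψ) + N • Ψ = (N * κ) • T := by
    rw [map_zsmul, ← zsmul_add, hcΨ, smul_smul]
  have hΨq' : (2 : ℤ) • (N • Ψq) = N • y + N • Pq := by
    rw [smul_comm, hΨq, zsmul_add]
  have hcΨq' : c (N • Ψq) + N • Ψq = 0 := by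
    rw [map_zsmul, ← zsmul_add, hcΨq, zsmul_zero]
  have hPe' : N • Pe = (4 : ℤ) • ((Mq * Mp) • Re) + (Mq * Mp) • te := by
    rw [show N = (Mq * Mp) * Me by rw [hNdef]; ring, mul_zsmul, hPe, zsmul_add, smul_comm]
  have hRe' : c ((Mq * Mp) • Re) + (Mq * Mp) • Re = ((Mq * Mp) * εe) • T := by
    rw [map_zsmul, ← zsmul_add, hRe, smul_smul]
  have hPp' : N • Pp = (4 : ℤ) • ((Me * Mq) • Rp) + (Me * Mq) • tp := by
    rw [show N = (Me * Mq) * Mp by rw [hNdef], mul_zsmul, hPp, zsmul_add, smul_comm]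
  have hRp' : c ((Me * Mq) • Rp) + (Me * Mq) • Rp = ((Me * Mq) * εp) • T := by
    rw [map_zsmul, ← zsmul_add, hRp, smul_smul]
  have hPq' : N • Pq = ((Me * Mp) * n) • Y + (Me * Mp) • tq := by
    rw [show N = (Me * Mp) * Mq by rw [hNdef]; ring, mul_zsmul, hPq, zsmul_add, smul_smul]
  obtain ⟨n₂, hn₂, hpar⟩ := quarterTrace_parity c hT2 hT0 h4 hcT hΨ' hcΨ' hΨq' hcΨq'
    (zsmul_mem_zero_or_twoTorsion hT2 hy N) hPe' hRe' (zsmul_mem_zero_or_twoTorsion hT2 hte _)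
    hPp' hRp' (zsmul_mem_zero_or_twoTorsion hT2 htp _) hPq' hY (zsmul_mem_zero_or_twoTorsion hT2 htq _)
  refine ⟨n₂, hn₂, ?_⟩
  -- odd multipliers do not change parities
  have h1 : Even (N * κ - κ) := by
    rw [show N * κ - κ = (N - 1) * κ by ring]; exact (hN.sub_odd odd_one).mul_right κ
  have h2 : Even ((Mq * Mp) * εe - εe) := by
    rw [show (Mq * Mp) * εe - εe = (Mq * Mp - 1) * εe by ring]; exact ((hMq.mul hMp).sub_odd odd_one).mul_right εe
  have h3 : Even ((Me * Mq) * εp - εp) := by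
    rw [show (Me * Mq) * εp - εp = (Me * Mq - 1) * εp by ring]; exact ((hMe.mul hMq).sub_odd odd_one).mul_right εp
  have e : κ - εe - εp - n₂ = (N * κ - (Mq * Mp) * εe - (Me * Mq) * εp - n₂)
      - (N * κ - κ) + ((Mq * Mp) * εe - εe) + ((Me * Mq) * εp - εp) := by ring
  rw [e]
  exact ((hpar.sub h1).add h2).add h3

end QuarterTraceCore

end Summit.BirchSwinnertonDyer.BirchSwinnertonDyer.Theorems.GoldfeldGoodTwists
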